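import Summits.HodgeConjecture.HodgeConjecture.Theorems.Q8SymplecticPowersStubFamilyDeckExistsQ
import Summits.HodgeConjecture.HodgeConjecture.Theorems.Q8SymplecticPowersGenericityPolynomials
import Summits.HodgeConjecture.HodgeConjecture.Theorems.Q8SymplecticPowersFibreBirational
import Literature.AlgebraicGeometry.HodgeTheory.BettiOneBirationalInvariance
import Literature.AlgebraicGeometry.HodgeTheory.BettiNumbersConstantInFamilies
import HarnessLib

/-!
# Route `Q8SymplecticPowers`, crux K1Q (stmt-HodgeConjecture-24190), line `mechanism-v2`: stub S1 `stub_regularVeryGeneralQ`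
# REDUCED TO ONE FIBRE — «b₁ = 0 for ONE fibre of the deck family model at each even `e ≥ 4`» implies S1 verbatim

Cell `hodge-nonav`, prover seat `hodge-nonav-prover-Bx` (g20), planner p3 g37 ORDER 14:56:48Z (β′). HELPER FILE
(`--supports stmt-HodgeConjecture-24190 --as helper`; nothing here closes an item). Sorry-free; axioms standard; no definition; no new named fact
(the Kollár binder is the line's registered print input of S6∕S8).

`stub_regularVeryGeneralQ_of_oneFibre hK HQ : <S1 verbatim>` where `HQ` says, over the SAME package binders as S4∕S5 (the S6 deck family
`W, 𝒳, π, τ, j, ι` with its clauses), that SOME fibre `X_{a₀}`, `a₀ ∈ W(ℂ)`, has `b₁ = 0`. PROOF: the family exists (S6 by name, from the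
Kollár fact); `W(ℂ)` is path connected (irreducible open of affine space, smooth: SGA1 XII 2.4 + manifold), so `b₁` is the same on every
fibre (Ehresmann, `finrank_bettiCohomology_fiberOver_eq_of_joined`); the genericity polynomials (`exists_genericityPolynomials`, G7, with no
bad set) give, for every admissible `(c, ψ)` off their zero sets, a point `t ∈ W(ℂ)` over `(c, ψ)` with the chart genericity element
non-zero, whose fibre is birational to `V_(c,ψ)` (G8 `birationalOver_fiberOver_of_deckClauses`); and `b₁` is a birational invariant of
smooth projective surfaces (`BettiUniverse.finrank_bettiCohomology_one_eq_of_birationalOver`, Hartshorne II Ex. 8.8 via Hironaka). So the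
residue of S1 is literally ONE number per `e`: `q(X_{a₀}) = 0` (Naie 2007 Thm 1.1 ∕ Esnault–Viehweg: cyclic multiple planes; memo (C56)).

Honest scope: a reduction; S1, K1Q, HC are NOT proved here.

References: R. Hartshorne, *Algebraic Geometry*, II Ex. 8.8, V Rem. 5.6.1; C. Voisin, *Hodge Theory I*, §9.1.1 Thm. 9.3; D. Naie, *The irregularity
of cyclic multiple planes after Zariski* (2007), Thm. 1.1.
-/

set_option linter.dupNamespace false

noncomputable section

open CategoryTheory AlgebraicGeometry MonoidalCategory CartesianMonoidalCategory
open Literature.AlgebraicGeometry Literature.AlgebraicGeometry.Motives Literature.AlgebraicGeometry.HodgeTheory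
open Literature.AlgebraicGeometry.HodgeTheory.BettiUniverse Literature.AlgebraicGeometry.HodgeTheory.Q8Family
open Literature.AlgebraicGeometry.RelativeSpec Literature.AlgebraicGeometry.RelativeSpec.ActionOver

namespace Summit.HodgeConjecture.HodgeConjecture.Theorems.Q8SymplecticPowersRegularOfOneFibre

/-- **`W(ℂ)` is path connected** for a non-empty open `W ⊆ 𝔸^{CIdx e}` with `base W` smooth of some relative dimension over `ℂ`
(irreducible ⇒ `W(ℂ)` connected, SGA1 XII Prop. 2.4 — the tree's `ComplexPoints.isConnected_setOf_pt_mem_of_isIrreducible_holds`;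
a connected manifold is path connected). [cite: SGA1, Exp. XII Prop. 2.4] -/
theorem pathConnectedSpace_complexPoints_base {e m : ℕ} (W : (Spec (.of (ParamRing e))).Opens) (hne : Nonempty (ComplexPoints (base W)))
    [SmoothOfRelativeDimension m (base W).hom] : PathConnectedSpace (ComplexPoints (base W)) := by
  have hirr : IrreducibleSpace (base W).left := by
    obtain ⟨t₀⟩ := hne
    haveI : IrreducibleSpace (Spec (CommRingCat.of (ParamRing e))) :=
      inferInstanceAs (IrreducibleSpace (PrimeSpectrum (ParamRing e)))
    change IrreducibleSpace W
    exact isIrreducible_iff_irreducibleSpace.mp ⟨⟨W.ι t₀.pt, by rw [← Scheme.Opens.range_ι]; exact ⟨t₀.pt, rfl⟩⟩,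
      (PreirreducibleSpace.isPreirreducible_univ (X := Spec (CommRingCat.of (ParamRing e)))).open_subset W.isOpen
        (Set.subset_univ _)⟩
  haveI := hirr
  haveI : Smooth (base W).hom := SmoothOfRelativeDimension.smooth m (base W).hom
  haveI : LocallyOfFiniteType (base W).hom := inferInstance
  haveI : ConnectedSpace (ComplexPoints (base W)) := by
    have h := Motives.ComplexPoints.isConnected_setOf_pt_mem_of_isIrreducible_holds (base W) isClosed_univ
      (IrreducibleSpace.isIrreducible_univ (X := ↥(base W).left))
    rw [connectedSpace_iff_univ]
    convert h using 1
    ext P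
    simp
  exact pathConnectedSpace_complexPoints_of_smoothOfRelativeDimension _ m

/-- **S1 reduced to one fibre.** Granted the line's print input (Kollár 2007 Thm. 3.36: functorial resolution, the binder of S6) and
`HQ` : for every even `e ≥ 4` and every deck-family package of S6 (same binders as S4∕S5), SOME fibre has `b₁ = 0` — the registered
statement of S1 holds: very generally every smooth projective `X` birational over `ℂ` to `V_(c,ψ)` has `b₁(X) = 0` (module docstring).
[cite: Hartshorne1977, II Ex. 8.8 and V Remark 5.6.1] [cite: VoisinHodgeI2002, §9.1.1 Thm. 9.3] [cite: Kollar2007, Thm. 3.36] -/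
theorem stub_regularVeryGeneralQ_of_oneFibre (hK : Literature.AlgebraicGeometry.Resolution.Kollar2007_resolutionLiftsAutomorphisms.{0})
    (HQ :     open Literature.AlgebraicGeometry.Motives Literature.AlgebraicGeometry.HodgeTheory Literature.AlgebraicGeometry.HodgeTheory.BettiUniverse Literature.AlgebraicGeometry.HodgeTheory.Q8Family Literature.AlgebraicGeometry.RelativeSpec Literature.AlgebraicGeometry.RelativeSpec.ActionOver Literature.Algebra.Lie Literature.Algebra.Lie.KatzRecognition CategoryTheory CategoryTheory.Limits MonoidalCategory CartesianMonoidalCategory AlgebraicGeometry in ∀ ⦃e : ℕ⦄, Even e → 4 ≤ e → ∀ (W : (Spec (.of (ParamRing e))).Opens) (𝒳 : SchemeOver ℂ) (π : 𝒳 ⟶ base W) (τ j : 𝒳 ⟶ 𝒳) (ι : (deckChart (fun i => (MvPolynomial.X i : ParamRing e)) ⊗ Over.mk W.ι).left ⟶ 𝒳.left), Nonempty (ComplexPoints (base W)) → ∀ (hπ : IsSmoothProjectiveFamily π 2), IsQuasiProjectiveOver 𝒳 → IsQuasiProjectiveOver (base W) → AlgebraicGeometry.SmoothOfRelativeDimension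 (Fintype.card (CIdx e)) (base W).hom → ∀ (hτπ : τ ≫ π = π) (hjπ : j ≫ π = π), τ ≫ τ ≫ τ ≫ τ = 𝟙 𝒳 → j ≫ j = τ ≫ τ → τ ≫ j ≫ τ = j → IsOpenImmersion ι → ι ≫ π.left = (snd (deckChart (fun i => (MvPolynomial.X i : ParamRing e))) (Over.mk W.ι)).left → ((Over.isoMk ((deckAction (fun i => (MvPolynomial.X i : ParamRing e))).aut (QuaternionGroup.a 1)) ((deckAction (fun i => (MvPolynomial.X i : ParamRing e))).aut_comp (QuaternionGroup.a 1))).hom ▷ Over.mk W.ι).left ≫ ι = ι ≫ τ.left → ((Over.isoMk ((deckAction (fun i => (MvPolynomial.X i : ParamRing e))).aut (QuaternionGroup.xa 0)) ((deckAction (fun i => (MvPolynomial.X i : ParamRing e))).aut_comp (QuaternionGroup.xa 0))).hom ▷ Over.mk W.ι).left ≫ ι = ι ≫ j.left → Function.Surjective (snd (deckChart (fun i => (MvPolynomial.X i : ParamRing e))) (Over.mk W.ι)).left → ∃ a₀ : ComplexPoints (base W), Module.finrank ℚ (bettiCohomology (fiberOver π a₀) 1) = 0) :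
open Literature.AlgebraicGeometry.Motives Literature.AlgebraicGeometry.HodgeTheory Literature.AlgebraicGeometry.HodgeTheory.BettiUniverse CategoryTheory.Limits in ∀ ⦃e : ℕ⦄, Even e → 4 ≤ e → ∃ G : ℕ → MvPolynomial ({d : Fin 3 →₀ ℕ // d.degree = 1} ⊕ {d : Fin 3 →₀ ℕ // d.degree = e - 1}) ℂ, (∀ i, ∃ c ψ : MvPolynomial (Fin 3) ℂ, c.IsHomogeneous 1 ∧ ψ.IsHomogeneous (e - 1) ∧ MvPolynomial.rename (Equiv.swap (0 : Fin 3) 1) ψ = ψ ∧ MvPolynomial.eval (Sum.elim (fun d => c.coeff d.1) (fun d => ψ.coeff d.1)) (G i) ≠ 0) ∧ ∀ c ψ : MvPolynomial (Fin 3) ℂ, c.IsHomogeneous 1 → ψ.IsHomogeneous (e - 1) → MvPolynomial.rename (Equiv.swap (0 : Fin 3) 1) ψ = ψ → (∀ i, MvPolynomial.eval (Sum.elim (fun d => c.coeff d.1) (fun d => ψ.coeff d.1)) (G i) ≠ 0) → ∀ ⦃V X : SchemeOver ℂ⦄ (hX : IsSmoothProjective 2 X), IsHypersurfaceCutOutBy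 3 (MvPolynomial.X (Fin.last 3) ^ 4 * MvPolynomial.X (Fin.castSucc 2) ^ (2 * e) - MvPolynomial.rename Fin.castSucc (c * MvPolynomial.rename (Equiv.swap (0 : Fin 3) 1) c ^ 3 * ((MvPolynomial.X 0 - MvPolynomial.X 1) * ψ) ^ 2)) V → AlgebraicGeometry.Scheme.BirationalOver X.hom V.hom → Module.finrank ℚ (bettiCohomology X 1) = 0 := by
  intro e he h4
  obtain ⟨W, 𝒳, π, τ, j, ι, hne, hπ, hqp, hqpW, hsm, ⟨hτπ, hjπ, hτ4, hj2, hτjτ⟩, hιo, hιπ, hιτ, hιj, hsurj⟩ :=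
    Q8SymplecticPowersStubFamilyDeckExistsQ.stub_familyDeckExistsQ hK he h4
  obtain ⟨a₀, ha₀⟩ := HQ he h4 W 𝒳 π τ j ι hne hπ hqp hqpW hsm hτπ hjπ hτ4 hj2 hτjτ hιo hιπ hιτ hιj hsurj
  haveI := hsm
  haveI : PathConnectedSpace (ComplexPoints (base W)) := pathConnectedSpace_complexPoints_base (m := Fintype.card (CIdx e)) W hne
  -- the genericity polynomials, with no bad set
  have hBad : ∀ j : ℕ, IsZariskiClosedOnPoints (base W) ((fun _ : ℕ => (∅ : Set (ComplexPoints (base W)))) j) ∧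
      (fun _ : ℕ => (∅ : Set (ComplexPoints (base W)))) j ≠ Set.univ := by
    intro j'
    refine ⟨⟨∅, isClosed_empty, by ext P; simp⟩, ?_⟩
    obtain ⟨t₀⟩ := hne
    intro h
    have ht₀ : t₀ ∈ (Set.univ : Set (ComplexPoints (base W))) := Set.mem_univ _
    rw [← h] at ht₀
    exact ht₀
  obtain ⟨G, hGne, hGpt⟩ := Q8SymplecticPowersGenericityPolynomials.exists_genericityPolynomials W hne (fun _ => ∅) hBad
    (genericityElem e) (genericityElem_ne_zero e (by omega))
  refine ⟨G, hGne, ?_⟩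
  intro c ψ hc hψ hψσ hGi V X hX hV hbir
  obtain ⟨t, htc, htψ, -, hGe⟩ := hGpt c ψ hc hψ hψσ hGi
  -- the fibre over `t` is birational to `V_(c,ψ)` (G8), hence to `X`
  have hbV := Q8SymplecticPowersFibreBirational.birationalOver_fiberOver_of_deckClauses (by omega) W 𝒳 π ι hπ hιo hιπ hsurj t hGe
    (V := V) (by rw [htc, htψ]; exact hV)
  rw [finrank_bettiCohomology_one_eq_of_birationalOver hX (hπ.isSmoothProjective t) (hbir.trans hbV.symm),
    finrank_bettiCohomology_fiberOver_eq_of_joined π hπ hqpW (d := Fintype.card (CIdx e)) (PathConnectedSpace.joined t a₀) 1]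
  exact ha₀

end Summit.HodgeConjecture.HodgeConjecture.Theorems.Q8SymplecticPowersRegularOfOneFibre

end
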